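import Summits.BirchSwinnertonDyer.BirchSwinnertonDyer.Theorems.ClassRecordThreeIMCDivTwoLociAtThreeRFromThm57Transfer
import Summits.BirchSwinnertonDyer.BirchSwinnertonDyer.Theorems.ClassRecordThreeIMCDivAtThreeLambdaMatchingCut
import HarnessLib

/-!
# ROAD B12 @3 — PART B (route-coned): items 20262 `IMCDivTwoLociAtThreeR` and 20263 `IMCDivTwoLociTamAtThreeR` BY NAME
# from {Yan–Zhu 2026 Thm 5.7 (1), BCS25 Prop 4.2.2, UB₃♯, TRANSFER₃} — p505319's composition fed by PART A
# (`ClassRecordThreeIMCDivTwoLociAtThreeRFromThm57Transfer.lean`: INV₃ verbatim from the four hypotheses, UB₃ from UB₃♯)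

Cell `bsd-stepL` (run/shared/lean/pub/bsd-stepL/), seat `bsd-stepL-bdp` (prover g23, 2026-08-27). `--supports
stmt-BirchSwinnertonDyer-20262 --as helper`. THEOREMS ONLY. Memo: HOME/proof/PROOF-BDP.md §57. Split from PART A only
because p505319's by-name composition imports the route file (theses-cone lint) and for the 400-line cap.
HONEST FRAMING: CONDITIONAL theorems (two PRINT facts by name + the two OPEN typed shapes UB₃♯ ∕ TRANSFER₃); nothing is
discharged, booked or re-labelled (T7); O2 stays OPEN; BSD(E,3) is proved for no class.
References: [YanZhu2024MainConjNonCM] Thm. 5.7 (1); [BurungaleCastellaSkinner2025] Prop. 4.2.2; [Washington1997] §7.1, §13.2;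
[EmertonPollackWeston2006] Thm. 1.
-/

set_option autoImplicit false
set_option linter.dupNamespace false

noncomputable section

open scoped Classical

open WeierstrassCurve NumberField IsDedekindDomain Field PowerSeries
  Literature.NumberTheory.EllipticCurves Literature.NumberTheory.EllipticCurves.ModularForms
  Literature.NumberTheory.EllipticCurves.Rank1Residual
  Literature.NumberTheory.GaloisRepresentations
  Summit.BirchSwinnertonDyer.Rank1Residual Summit.BirchSwinnertonDyer.Rank1Residual.X11b
  Summit.BirchSwinnertonDyer.Rank1Residual.X11b.AcSelmer
  Summit.BirchSwinnertonDyer.Rank1Residual.X11b.CongruenceLimit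
  Summit.BirchSwinnertonDyer.Rank1Residual.X11b.Halves
  Summit.BirchSwinnertonDyer.Rank1Residual.X11b.Three
  Summit.BirchSwinnertonDyer.Rank1Residual.X1.KellerYinHalves
  Summit.BirchSwinnertonDyer.BirchSwinnertonDyer.Theorems.LambdaMatching
  Summit.BirchSwinnertonDyer.BirchSwinnertonDyer.Theorems.UniversalToricDescentTwinSplit
  Summit.BirchSwinnertonDyer.BirchSwinnertonDyer.Theorems.SchneiderFree

namespace Summit.BirchSwinnertonDyer.BirchSwinnertonDyer.Theorems.LambdaMatchingAtThree

/-- **Item 20262 `IMCDivTwoLociAtThreeR` BY NAME ⟸ {Yan–Zhu 5.7 (1), BCS25 Prop 4.2.2, UB₃♯, TRANSFER₃}** —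
ROAD B12 at `3 ∥ N` with the INV brick resolved into its sources (p505319's composition fed by
`ub3_of_upperDivisibility` and `inv3_of_thm57_of_upperDivisibility_of_transfer`). CONDITIONAL on the two PRINT facts
(by name) and the two OPEN shapes UB₃♯ (memo §55) ∕ TRANSFER₃ (memo §40 ∕ §37.11 + partner census §57.3); nothing booked.
[cite: YanZhu2024MainConjNonCM, Thm. 5.7 (1)] [cite: BurungaleCastellaSkinner2025, Prop. 4.2.2 (μ = 0, after Hsieh 2014 Thm. B)]
[cite: Washington1997, §7.1 Prop. 7.2 and §13.2] [cite: EmertonPollackWeston2006, Thm. 1 (the mechanism)] -/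
theorem imcDivTwoLociAtThreeR_of_thm57_of_upperDivisibility_of_transfer
    (h57 : YanZhu2026.thm57_isTorsion_charIdealXGr_eq_bdpLFunction)
    (h422 : BurungaleCastellaSkinner2025.prop422_exists_isBDPLFunction_mu_eq_zero)
    (hUB : ∀ (W : WeierstrassCurve ℚ) [W.IsElliptic] [W.IsGloballyMinimal],
      ClassX11b W 3 → Surj W 3 → (Ram W 3 → W.HasSplitMultiplicativeReductionAtPrime 3) →
      ∀ (N : ℕ) [NeZero N] (K : Type) [Field K] [NumberField K] (Dt : ModularParametrizationData W N)
      (H : HeegnerDatum N (NumberField.discr K)) (ι : K →+* ℂ) (P : (W.baseChange K).toAffine.Point),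
      ClassX11b W 3 → Surj W 3 → W.conductorNorm ℤ = N → IsImaginaryQuadratic K →
      Odd (NumberField.discr K) → SatisfiesHeegnerHypothesis N K →
      (W.quadraticTwist (NumberField.discr K : ℚ)).entireLFunction 1 ≠ 0 →
      WeierstrassCurve.Affine.Point.map ι.toRatAlgHom P = heegnerPointComplex Dt H →
      ¬ (3 : ℤ) ∣ Dt.c → ¬ IsOfFinAddOrder P →
      ∀ (κ : ZpExtension K 3), κ.IsAnticyclotomic →
        ∀ (γ : Field.absoluteGaloisGroup K) [Fact (κ.IsTopGenerator γ)]
          (𝔭 : HeightOneSpectrum (𝓞 K)), ((3 : ℕ) : 𝓞 K) ∈ 𝔭.asIdeal →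
          𝔭.asIdeal.ramificationIdx (𝓞 ℚ) = 1 → 𝔭.asIdeal.inertiaDeg (𝓞 ℚ) = 1 →
          ∀ (f : CuspForm (CongruenceSubgroup.Gamma0 N) 2), IsNewformOf W f →
            ∀ (ι' : PadicAlgCl 3 ≃+* ℂ), InducesPrime ι' 𝔭 →
              ∀ (ΩK : ℂ) (Ωp : (unrIntegers 3)ˣ) (L : UnrSeries 3), ΩK ≠ 0 →
                IsBDPLFunction ι' 𝔭 κ γ f ΩK ((Ωp : unrIntegers 3) : ℂ_[3]) L →
                  ∀ (𝔭bar : HeightOneSpectrum (𝓞 K)), ((3 : ℕ) : 𝓞 K) ∈ 𝔭bar.asIdeal → 𝔭bar ≠ 𝔭 →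
                    L ∈ (XAc.charIdeal (W.baseChange K) 3 κ 𝔭bar ∅ γ).map (PowerSeries.map (toUnr 3)))
    (hTR : ∀ (W : WeierstrassCurve ℚ) [W.IsElliptic] [W.IsGloballyMinimal],
      ClassX11b W 3 → Surj W 3 → (Ram W 3 → W.HasSplitMultiplicativeReductionAtPrime 3) →
      ∀ (N : ℕ) [NeZero N] (K : Type) [Field K] [NumberField K] (Dt : ModularParametrizationData W N)
      (H : HeegnerDatum N (NumberField.discr K)) (ι : K →+* ℂ) (P : (W.baseChange K).toAffine.Point),
      ClassX11b W 3 → Surj W 3 → W.conductorNorm ℤ = N → IsImaginaryQuadratic K →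
      Odd (NumberField.discr K) → SatisfiesHeegnerHypothesis N K →
      (W.quadraticTwist (NumberField.discr K : ℚ)).entireLFunction 1 ≠ 0 →
      WeierstrassCurve.Affine.Point.map ι.toRatAlgHom P = heegnerPointComplex Dt H →
      ¬ (3 : ℤ) ∣ Dt.c → ¬ IsOfFinAddOrder P →
      ∀ (κ : ZpExtension K 3), κ.IsAnticyclotomic →
        ∀ (γ : Field.absoluteGaloisGroup K) [Fact (κ.IsTopGenerator γ)]
          (𝔭 : HeightOneSpectrum (𝓞 K)), ((3 : ℕ) : 𝓞 K) ∈ 𝔭.asIdeal →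
          𝔭.asIdeal.ramificationIdx (𝓞 ℚ) = 1 → 𝔭.asIdeal.inertiaDeg (𝓞 ℚ) = 1 →
          ∀ (f : CuspForm (CongruenceSubgroup.Gamma0 N) 2), IsNewformOf W f →
            ∀ (ι' : PadicAlgCl 3 ≃+* ℂ), InducesPrime ι' 𝔭 →
              ∀ (ΩK : ℂ) (Ωp : (unrIntegers 3)ˣ) (L : UnrSeries 3), ΩK ≠ 0 →
                IsBDPLFunction ι' 𝔭 κ γ f ΩK ((Ωp : unrIntegers 3) : ℂ_[3]) L →
                  ∀ (𝔭bar : HeightOneSpectrum (𝓞 K)), ((3 : ℕ) : 𝓞 K) ∈ 𝔭bar.asIdeal → 𝔭bar ≠ 𝔭 →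
                    ∃ (W' : WeierstrassCurve ℚ) (_ : W'.IsElliptic) (_ : W'.IsGloballyMinimal) (N' : ℕ)
                      (_ : NeZero N') (Dt' : ModularParametrizationData W' N'),
                      GoodOrd W' 3 ∧ Surj W' 3 ∧ SatisfiesHeegnerHypothesis N' K ∧
                      ∀ (g g' : IwasawaAlgebra 3),
                        XAc.charIdeal (W.baseChange K) 3 κ 𝔭bar ∅ γ = Ideal.span {g} →
                        XAc.charIdeal (W'.baseChange K) 3 κ 𝔭bar ∅ γ = Ideal.span {g'} →
                        ∀ (ΩK' : ℂ) (Ωp' : (unrIntegers 3)ˣ) (L' : UnrSeries 3), ΩK' ≠ 0 →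
                          IsBDPLFunction ι' 𝔭 κ γ Dt'.f ΩK' ((Ωp' : unrIntegers 3) : ℂ_[3]) L' →
                          ∃ (P P' u : UnrSeries 3) (m m' : ℕ),
                            (‖((coeff m (P) : unrIntegers 3) : ℂ_[3])‖ = 1 ∧
                              ∀ i < m, ‖((coeff i (P) : unrIntegers 3) : ℂ_[3])‖ < 1) ∧
                            (‖((coeff m' (P') : unrIntegers 3) : ℂ_[3])‖ = 1 ∧
                              ∀ i < m', ‖((coeff i (P') : unrIntegers 3) : ℂ_[3])‖ < 1) ∧
                            IsUnit u ∧
                            (∀ i, ‖((coeff i (u * (L' * P')) : unrIntegers 3) : ℂ_[3]) -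
                              ((coeff i (L * P) : unrIntegers 3) : ℂ_[3])‖ < 1) ∧
                            ((∃ a, (‖((coeff a (PowerSeries.map (toUnr 3) g * P) : unrIntegers 3) : ℂ_[3])‖ = 1 ∧
                                ∀ i < a, ‖((coeff i (PowerSeries.map (toUnr 3) g * P) : unrIntegers 3) : ℂ_[3])‖ < 1)) →
                              ∃ a', (‖((coeff a' (PowerSeries.map (toUnr 3) g' * P') : unrIntegers 3) : ℂ_[3])‖ = 1 ∧
                                ∀ i < a', ‖((coeff i (PowerSeries.map (toUnr 3) g' * P') : unrIntegers 3) : ℂ_[3])‖ < 1)) ∧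
                            (∀ a a', (‖((coeff a (PowerSeries.map (toUnr 3) g * P) : unrIntegers 3) : ℂ_[3])‖ = 1 ∧
                                ∀ i < a, ‖((coeff i (PowerSeries.map (toUnr 3) g * P) : unrIntegers 3) : ℂ_[3])‖ < 1) →
                              (‖((coeff a' (PowerSeries.map (toUnr 3) g' * P') : unrIntegers 3) : ℂ_[3])‖ = 1 ∧
                                ∀ i < a', ‖((coeff i (PowerSeries.map (toUnr 3) g' * P') : unrIntegers 3) : ℂ_[3])‖ < 1) → a = a')) :
    Summit.BirchSwinnertonDyer.BirchSwinnertonDyer.Theses.ClassRecordThree.IMCDivTwoLociAtThreeR :=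
  imcDivTwoLociAtThreeR_of_ratUpperBound_of_invariantsMatch (ub3_of_upperDivisibility hUB)
    (inv3_of_thm57_of_upperDivisibility_of_transfer h57 h422 hUB hTR)

/-- **KOLY twin: item 20263 `IMCDivTwoLociTamAtThreeR` BY NAME from the same four hypotheses**
(`imcDivTwoLociTamAtThreeR_of_imcDivTwoLociAtThreeR`). CONDITIONAL; nothing booked.
[cite: YanZhu2024MainConjNonCM, Thm. 5.7 (1)] [cite: Washington1997, §7.1 Prop. 7.2 and §13.2] -/
theorem imcDivTwoLociTamAtThreeR_of_thm57_of_upperDivisibility_of_transfer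
    (h57 : YanZhu2026.thm57_isTorsion_charIdealXGr_eq_bdpLFunction)
    (h422 : BurungaleCastellaSkinner2025.prop422_exists_isBDPLFunction_mu_eq_zero)
    (hUB : ∀ (W : WeierstrassCurve ℚ) [W.IsElliptic] [W.IsGloballyMinimal],
      ClassX11b W 3 → Surj W 3 → (Ram W 3 → W.HasSplitMultiplicativeReductionAtPrime 3) →
      ∀ (N : ℕ) [NeZero N] (K : Type) [Field K] [NumberField K] (Dt : ModularParametrizationData W N)
      (H : HeegnerDatum N (NumberField.discr K)) (ι : K →+* ℂ) (P : (W.baseChange K).toAffine.Point),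
      ClassX11b W 3 → Surj W 3 → W.conductorNorm ℤ = N → IsImaginaryQuadratic K →
      Odd (NumberField.discr K) → SatisfiesHeegnerHypothesis N K →
      (W.quadraticTwist (NumberField.discr K : ℚ)).entireLFunction 1 ≠ 0 →
      WeierstrassCurve.Affine.Point.map ι.toRatAlgHom P = heegnerPointComplex Dt H →
      ¬ (3 : ℤ) ∣ Dt.c → ¬ IsOfFinAddOrder P →
      ∀ (κ : ZpExtension K 3), κ.IsAnticyclotomic →
        ∀ (γ : Field.absoluteGaloisGroup K) [Fact (κ.IsTopGenerator γ)]
          (𝔭 : HeightOneSpectrum (𝓞 K)), ((3 : ℕ) : 𝓞 K) ∈ 𝔭.asIdeal →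
          𝔭.asIdeal.ramificationIdx (𝓞 ℚ) = 1 → 𝔭.asIdeal.inertiaDeg (𝓞 ℚ) = 1 →
          ∀ (f : CuspForm (CongruenceSubgroup.Gamma0 N) 2), IsNewformOf W f →
            ∀ (ι' : PadicAlgCl 3 ≃+* ℂ), InducesPrime ι' 𝔭 →
              ∀ (ΩK : ℂ) (Ωp : (unrIntegers 3)ˣ) (L : UnrSeries 3), ΩK ≠ 0 →
                IsBDPLFunction ι' 𝔭 κ γ f ΩK ((Ωp : unrIntegers 3) : ℂ_[3]) L →
                  ∀ (𝔭bar : HeightOneSpectrum (𝓞 K)), ((3 : ℕ) : 𝓞 K) ∈ 𝔭bar.asIdeal → 𝔭bar ≠ 𝔭 →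
                    L ∈ (XAc.charIdeal (W.baseChange K) 3 κ 𝔭bar ∅ γ).map (PowerSeries.map (toUnr 3)))
    (hTR : ∀ (W : WeierstrassCurve ℚ) [W.IsElliptic] [W.IsGloballyMinimal],
      ClassX11b W 3 → Surj W 3 → (Ram W 3 → W.HasSplitMultiplicativeReductionAtPrime 3) →
      ∀ (N : ℕ) [NeZero N] (K : Type) [Field K] [NumberField K] (Dt : ModularParametrizationData W N)
      (H : HeegnerDatum N (NumberField.discr K)) (ι : K →+* ℂ) (P : (W.baseChange K).toAffine.Point),
      ClassX11b W 3 → Surj W 3 → W.conductorNorm ℤ = N → IsImaginaryQuadratic K →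
      Odd (NumberField.discr K) → SatisfiesHeegnerHypothesis N K →
      (W.quadraticTwist (NumberField.discr K : ℚ)).entireLFunction 1 ≠ 0 →
      WeierstrassCurve.Affine.Point.map ι.toRatAlgHom P = heegnerPointComplex Dt H →
      ¬ (3 : ℤ) ∣ Dt.c → ¬ IsOfFinAddOrder P →
      ∀ (κ : ZpExtension K 3), κ.IsAnticyclotomic →
        ∀ (γ : Field.absoluteGaloisGroup K) [Fact (κ.IsTopGenerator γ)]
          (𝔭 : HeightOneSpectrum (𝓞 K)), ((3 : ℕ) : 𝓞 K) ∈ 𝔭.asIdeal →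
          𝔭.asIdeal.ramificationIdx (𝓞 ℚ) = 1 → 𝔭.asIdeal.inertiaDeg (𝓞 ℚ) = 1 →
          ∀ (f : CuspForm (CongruenceSubgroup.Gamma0 N) 2), IsNewformOf W f →
            ∀ (ι' : PadicAlgCl 3 ≃+* ℂ), InducesPrime ι' 𝔭 →
              ∀ (ΩK : ℂ) (Ωp : (unrIntegers 3)ˣ) (L : UnrSeries 3), ΩK ≠ 0 →
                IsBDPLFunction ι' 𝔭 κ γ f ΩK ((Ωp : unrIntegers 3) : ℂ_[3]) L →
                  ∀ (𝔭bar : HeightOneSpectrum (𝓞 K)), ((3 : ℕ) : 𝓞 K) ∈ 𝔭bar.asIdeal → 𝔭bar ≠ 𝔭 →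
                    ∃ (W' : WeierstrassCurve ℚ) (_ : W'.IsElliptic) (_ : W'.IsGloballyMinimal) (N' : ℕ)
                      (_ : NeZero N') (Dt' : ModularParametrizationData W' N'),
                      GoodOrd W' 3 ∧ Surj W' 3 ∧ SatisfiesHeegnerHypothesis N' K ∧
                      ∀ (g g' : IwasawaAlgebra 3),
                        XAc.charIdeal (W.baseChange K) 3 κ 𝔭bar ∅ γ = Ideal.span {g} →
                        XAc.charIdeal (W'.baseChange K) 3 κ 𝔭bar ∅ γ = Ideal.span {g'} →
                        ∀ (ΩK' : ℂ) (Ωp' : (unrIntegers 3)ˣ) (L' : UnrSeries 3), ΩK' ≠ 0 →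
                          IsBDPLFunction ι' 𝔭 κ γ Dt'.f ΩK' ((Ωp' : unrIntegers 3) : ℂ_[3]) L' →
                          ∃ (P P' u : UnrSeries 3) (m m' : ℕ),
                            (‖((coeff m (P) : unrIntegers 3) : ℂ_[3])‖ = 1 ∧
                              ∀ i < m, ‖((coeff i (P) : unrIntegers 3) : ℂ_[3])‖ < 1) ∧
                            (‖((coeff m' (P') : unrIntegers 3) : ℂ_[3])‖ = 1 ∧
                              ∀ i < m', ‖((coeff i (P') : unrIntegers 3) : ℂ_[3])‖ < 1) ∧
                            IsUnit u ∧
                            (∀ i, ‖((coeff i (u * (L' * P')) : unrIntegers 3) : ℂ_[3]) -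
                              ((coeff i (L * P) : unrIntegers 3) : ℂ_[3])‖ < 1) ∧
                            ((∃ a, (‖((coeff a (PowerSeries.map (toUnr 3) g * P) : unrIntegers 3) : ℂ_[3])‖ = 1 ∧
                                ∀ i < a, ‖((coeff i (PowerSeries.map (toUnr 3) g * P) : unrIntegers 3) : ℂ_[3])‖ < 1)) →
                              ∃ a', (‖((coeff a' (PowerSeries.map (toUnr 3) g' * P') : unrIntegers 3) : ℂ_[3])‖ = 1 ∧
                                ∀ i < a', ‖((coeff i (PowerSeries.map (toUnr 3) g' * P') : unrIntegers 3) : ℂ_[3])‖ < 1)) ∧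
                            (∀ a a', (‖((coeff a (PowerSeries.map (toUnr 3) g * P) : unrIntegers 3) : ℂ_[3])‖ = 1 ∧
                                ∀ i < a, ‖((coeff i (PowerSeries.map (toUnr 3) g * P) : unrIntegers 3) : ℂ_[3])‖ < 1) →
                              (‖((coeff a' (PowerSeries.map (toUnr 3) g' * P') : unrIntegers 3) : ℂ_[3])‖ = 1 ∧
                                ∀ i < a', ‖((coeff i (PowerSeries.map (toUnr 3) g' * P') : unrIntegers 3) : ℂ_[3])‖ < 1) → a = a')) :
    Summit.BirchSwinnertonDyer.BirchSwinnertonDyer.Theses.KolyvaginRoadThree.IMCDivTwoLociTamAtThreeR :=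
  imcDivTwoLociTamAtThreeR_of_imcDivTwoLociAtThreeR
    (imcDivTwoLociAtThreeR_of_thm57_of_upperDivisibility_of_transfer h57 h422 hUB hTR)

end Summit.BirchSwinnertonDyer.BirchSwinnertonDyer.Theorems.LambdaMatchingAtThree

end
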